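import Summits.CriticalPhenomena.SAWScalingLimit.Theorems.SAWDevelopingMapObservableToSLETypeLadderCarvedReductionSqueezeStrips
import Summits.CriticalPhenomena.SAWScalingLimit.Theorems.SAWDevelopingMapObservableToSLETypeLadderCarvedReductionSqueezeLinkPolyline
import Summits.CriticalPhenomena.SAWScalingLimit.Theorems.SAWDevelopingMapObservableToSLETypeLadderCarvedReductionSqueezeGateBounds
import HarnessLib

/-!
# Transfer of the reach clause (R) to the outer approximants (piece (T-A′₂F reach transfer) of
# stub T-A′₂F `stub_carvedReduction_squeezeGeometry_domainsCoreF`)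

Crux `SAWDevelopingMap.ObservableToSLE` (stmt-CriticalPhenomena-10472), line `six-class-type-ladder`,
stub T-A′₂F `stub_carvedReduction_squeezeGeometry_domainsCoreF`.  Landing target:
`Summits/CriticalPhenomena/SAWScalingLimit/Theorems/SAWDevelopingMapObservableToSLETypeLadderCarvedReductionSqueezeReachTransfer.lean`.

The outer approximant `E_n` keeps the whole good component `G'` of `b₀` in `E ∖ Zc`
(`outerSeq`, `Zc = closure (Z'_n ∩ E)`).  `reach_transfer_level` shows, at one level, that every
pinned vertex `ỹ` of a present walk `π` from the gate vertex `q` of the carved graph, and every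
point of `closedBall ỹ (25 s) ∩ E`, lies in `G'` — given the reach clause of the super-domain
(`superSup`: `ỹ ∈ E`, `closedBall ỹ (25 s) ⊆ E ∪ slabs`), presence above the gate lines, the
persistence margin `closedBall ỹ (25 s) ∩ Zc = ∅`, the frame boxes off `E`, the window strips
inside `E ∖ Zc` (`gateV`, `joinedIn_gateV`), and `q̃ ∈ G'`: the pinned polyline of `π` runs in
`E ∖ Zc` (its edges are short and avoid the slabs, which hug the gate lines from below while
present vertices near a gate sit above its line), a ball far from the gates lies in `E`, and a
ball near a gate lies in a window strip, joined to the upper half-window by a vertical dodge of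
the frame box.
Registered carrier: `stub_carvedReduction_reachTransfer`.
-/

noncomputable section

open scoped Topology
open Filter Set Metric
open Literature.Probability.LatticeModels (HexVertex hexGraph hexCenter triEmbed Site)
open Literature.Probability.RandomPlanarGeometry
open Literature.Probability.RandomPlanarGeometry.SAW

namespace Summit.CriticalPhenomena.SAWScalingLimit.Theorems.ObservableToSLE.TypeLadder

open Summit.CriticalPhenomena.SAWScalingLimit.Theorems.ObservableToSLER.TwoPiece (dist_smul_hexCenter_le_of_adj)

/-- Points joined inside `F` to a point of the `b₀`-component of `F` lie in that component. -/
theorem mem_component_of_joinedIn {F : Set ℂ} {b₀ z z' : ℂ} (hz : z ∈ connectedComponentIn F b₀) (h : JoinedIn F z z') :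
    z' ∈ connectedComponentIn F b₀ := by
  rw [connectedComponentIn_eq hz]
  exact mem_bulk_of_joinedIn h

/-- **THE REACH CLAUSE AT ONE LEVEL TRANSFERS TO THE GOOD COMPONENT**; see the module docstring.
Pinned points are `ṽ = s c_v - τⱼ`; the slabs are those of the reach clause of `superSup`. -/
theorem reach_transfer_level {E Zc Ω₀ : Set ℂ} {P : Fin 2 → ℂ} {b₀ τj : ℂ} {ρ t s : ℝ} {U : Set HexVertex}
    {q w : HexVertex} (π : (hexDomainGraph Ω₀ s).Walk q w) (hs : 0 < s) (hρ : 0 < ρ) (ht : 25 * s < t)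
    (htρ : t ≤ ρ / 128)
    (hV : ∀ i, pathComponentIn (gateV (P i) ρ t) (P i + ((ρ / 16 : ℝ) : ℂ) * Complex.I) ⊆ E \ Zc)
    (hbG : ∀ i, P i + ((ρ / 16 : ℝ) : ℂ) * Complex.I ∈ connectedComponentIn (E \ Zc) b₀)
    (hq : (s : ℂ) * hexCenter q - τj ∈ connectedComponentIn (E \ Zc) b₀)
    (hsupp : ∀ y ∈ π.support, y ∉ U)
    (hR : ∀ y ∈ π.support, (s : ℂ) * hexCenter y - τj ∈ E ∧
      closedBall ((s : ℂ) * hexCenter y - τj) (25 * s) ⊆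
        E ∪ ⋃ i, {z : ℂ | |z.re - (P i).re| ≤ ρ / 64 ∧ (P i).im - 30 * s ≤ z.im ∧ z.im ≤ (P i).im})
    (hup : ∀ v : HexVertex, v ∉ U → ∀ i, dist ((s : ℂ) * hexCenter v - τj) (P i) < ρ / 2 →
      (P i).im < ((s : ℂ) * hexCenter v - τj).im)
    (hZfar : ∀ y ∈ π.support, ∀ z : ℂ, dist z ((s : ℂ) * hexCenter y - τj) ≤ 25 * s → z ∉ Zc)
    (hbox : ∀ i (z : ℂ), z ∈ gateRect (P i) ρ → z ∉ E) :
    ∀ y ∈ π.support, (s : ℂ) * hexCenter y - τj ∈ connectedComponentIn (E \ Zc) b₀ ∧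
      closedBall ((s : ℂ) * hexCenter y - τj) (25 * s) ∩ E ⊆ connectedComponentIn (E \ Zc) b₀ := by
  set G' : Set ℂ := connectedComponentIn (E \ Zc) b₀ with hG'
  set bb : Fin 2 → ℂ := fun i => P i + ((ρ / 16 : ℝ) : ℂ) * Complex.I with hbb
  -- a slab point is close to its gate
  have hslab : ∀ i (z : ℂ), |z.re - (P i).re| ≤ ρ / 64 → (P i).im - 30 * s ≤ z.im → z.im ≤ (P i).im →
      dist z (P i) < ρ / 32 := by
    intro i z h1 h2 h3
    rw [dist_eq_norm]
    refine (Complex.norm_le_abs_re_add_abs_im _).trans_lt ?_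
    rw [Complex.sub_re, Complex.sub_im]
    have : |z.im - (P i).im| ≤ 30 * s := by rw [abs_le]; constructor <;> linarith
    linarith
  have h25 : s ≤ 25 * s := by linarith
  -- (1) the pinned polyline runs in `E ∖ Zc`
  have hseg : ∀ u v : HexVertex, (hexDomainGraph Ω₀ s).Adj u v → u ∈ π.support → v ∈ π.support →
      segment ℝ ((s : ℂ) * hexCenter u - τj) ((s : ℂ) * hexCenter v - τj) ⊆ E \ Zc := by
    intro u v hadj hu hv p hp
    have hadj' : hexGraph.Adj u v :=
      ((embMeshGraph_adj_iff hexGraph hexCenter).1 ((embDomainGraph_adj_iff hexGraph hexCenter).1 hadj).1).1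
    have hduv : dist ((s : ℂ) * hexCenter v - τj) ((s : ℂ) * hexCenter u - τj) ≤ s := by
      rw [dist_sub_right, dist_comm]; exact dist_smul_hexCenter_le_of_adj hs.le hadj'
    have hpu : dist p ((s : ℂ) * hexCenter u - τj) ≤ s := by
      have h1 := (convex_closedBall ((s : ℂ) * hexCenter u - τj) s).segment_subset (mem_closedBall_self hs.le)
        (mem_closedBall.2 hduv) hp
      exact mem_closedBall.1 h1
    refine ⟨?_, hZfar u hu p (hpu.trans h25)⟩
    rcases (hR u hu).2 (mem_closedBall.2 (hpu.trans h25)) with hpE | hpS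
    · exact hpE
    · exfalso
      obtain ⟨i, h1, h2, h3⟩ := mem_iUnion.1 hpS
      have hpP := hslab i p h1 h2 h3
      have huP : dist ((s : ℂ) * hexCenter u - τj) (P i) < ρ / 32 + s := by
        have h4 := dist_triangle ((s : ℂ) * hexCenter u - τj) p (P i)
        rw [dist_comm ((s : ℂ) * hexCenter u - τj) p] at h4
        linarith
      have hvP : dist ((s : ℂ) * hexCenter v - τj) (P i) < ρ / 32 + 2 * s := by
        have h4 := dist_triangle ((s : ℂ) * hexCenter v - τj) ((s : ℂ) * hexCenter u - τj) (P i)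
        linarith
      have hu' := hup u (hsupp u hu) i (by linarith)
      have hv' := hup v (hsupp v hv) i (by linarith)
      have habove : p ∈ {z : ℂ | (P i).im < z.im} :=
        (convex_halfSpace_im_gt _).segment_subset (show (s : ℂ) * hexCenter u - τj ∈ {z : ℂ | (P i).im < z.im} from hu')
          (show (s : ℂ) * hexCenter v - τj ∈ {z : ℂ | (P i).im < z.im} from hv') hp
      simp only [mem_setOf_eq] at habove
      linarith
  have hvert : ∀ y ∈ π.support, (s : ℂ) * hexCenter y - τj ∈ G' := by
    intro y hy
    have hj := joinedIn_of_walk (fun v : HexVertex => (s : ℂ) * hexCenter v - τj) (π.takeUntil y hy)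
      (fun u v hadj hu hv => hseg u v hadj (π.support_takeUntil_subset_support hy hu)
        (π.support_takeUntil_subset_support hy hv)) (connectedComponentIn_subset _ _ hq)
    exact mem_component_of_joinedIn hq hj
  -- (2) the balls
  intro y hy
  refine ⟨hvert y hy, fun z hz => ?_⟩
  obtain ⟨hzb, hzE⟩ := hz
  rw [mem_closedBall] at hzb
  by_cases hnear : ∃ i, dist ((s : ℂ) * hexCenter y - τj) (P i) < ρ / 16
  · -- near a gate: the window strip
    obtain ⟨i, hi⟩ := hnear
    have hyup : (P i).im < ((s : ℂ) * hexCenter y - τj).im := hup y (hsupp y hy) i (by linarith)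
    have hzW : z ∈ gateW (P i) ρ t := by
      refine ⟨⟨?_, ?_⟩, fun h => hbox i z h hzE⟩
      · rw [mem_ball]; linarith [dist_triangle z ((s : ℂ) * hexCenter y - τj) (P i)]
      · show (P i).im - t < z.im
        have him : |(z - ((s : ℂ) * hexCenter y - τj)).im| ≤ dist z ((s : ℂ) * hexCenter y - τj) := by
          rw [dist_eq_norm]; exact Complex.abs_im_le_norm _
        rw [Complex.sub_im, abs_le] at him
        linarith
    have hj := joinedIn_gateV hρ (by linarith) htρ hzW
    have hbase : bb i ∈ gateV (P i) ρ t := gateW_subset_gateV hρ (base_mem_gateW hρ (by linarith))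
    have hzmem : z ∈ pathComponentIn (gateV (P i) ρ t) (bb i) := hj.symm
    have hpc : JoinedIn (pathComponentIn (gateV (P i) ρ t) (bb i)) (bb i) z :=
      (isPathConnected_pathComponentIn hbase).joinedIn _ (mem_pathComponentIn_self hbase) _ hzmem
    exact mem_component_of_joinedIn (hbG i) (hpc.mono (hV i))
  · -- far from the gates: the whole ball lies in `E`
    push Not at hnear
    have hball : closedBall ((s : ℂ) * hexCenter y - τj) (25 * s) ⊆ E \ Zc := by
      intro p hp
      refine ⟨?_, hZfar y hy p (mem_closedBall.1 hp)⟩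
      rcases (hR y hy).2 hp with hpE | hpS
      · exact hpE
      · exfalso
        obtain ⟨i, h1, h2, h3⟩ := mem_iUnion.1 hpS
        have hpP := hslab i p h1 h2 h3
        have h6 := hnear i
        have h4 := dist_triangle ((s : ℂ) * hexCenter y - τj) p (P i)
        rw [dist_comm ((s : ℂ) * hexCenter y - τj) p] at h4
        have h5 := mem_closedBall.1 hp
        linarith
    have hj : JoinedIn (E \ Zc) ((s : ℂ) * hexCenter y - τj) z :=
      JoinedIn.of_segment_subset (((convex_closedBall _ _).segment_subset (mem_closedBall_self (by positivity))
        (mem_closedBall.2 hzb)).trans hball)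
    exact mem_component_of_joinedIn (hvert y hy) hj

/-- **Registered carrier `stub_carvedReduction_reachTransfer`** (crux item stmt-CriticalPhenomena-10472,
stub T-A′₂F `stub_carvedReduction_squeezeGeometry_domainsCoreF`, piece THE REACH TRANSFER): points
joined inside `F` to a point of the `b₀`-component of `F` lie in that component. -/
theorem stub_carvedReduction_reachTransfer :
    ∀ (F : Set ℂ) (b₀ z z' : ℂ), z ∈ connectedComponentIn F b₀ → JoinedIn F z z' → z' ∈ connectedComponentIn F b₀ :=
  fun _ _ _ _ hz h => mem_component_of_joinedIn hz h

end Summit.CriticalPhenomena.SAWScalingLimit.Theorems.ObservableToSLE.TypeLadder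

end
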